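import Literature.LinearAlgebra.TensorNetworks.Basic
import Literature.Combinatorics.SimpleGraph.ListTreeDecomposition
import Mathlib.Data.Finset.Pi
import Mathlib.Algebra.BigOperators.Ring.Finset
import Mathlib.Order.Interval.Finset.Nat
import Mathlib.Tactic.Ring
import HarnessLib

/-!
# Sum-of-products evaluation along a rooted tree decomposition (junction-tree / bucket elimination)

Topic `Literature/LinearAlgebra/TensorNetworks`, sequel of `Basic.lean` (`TensorNetwork`, `value`,
`primalGraph`). Markov–Shi (*Simulating quantum computation by contracting tensor networks*,
SIAM J. Comput. 38 (2008), Thm. 4.6, Steps 3–4; Prop. 4.2) contract a tensor network along a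
contraction ordering read off a tree decomposition of its (line) graph, at a cost exponential only
in the width; in the sum-of-products presentation this is Dechter's *bucket elimination* /
the junction-tree algorithm (R. Dechter, Artif. Intell. 113 (1999), §4–5; cited by Markov–Shi, §1):
process the bags of a ROOTED tree decomposition leaves-first; at a bag `t`, multiply the factors
housed at `t` with the messages received from the children of `t`, sum out the variables of `t`
that do not occur in the parent bag, and pass the resulting table (indexed by the assignments of
`bag t ∩ bag (parent t)`) to the parent; the single entry left at the root is the value
`Σ_a ∏_f f(a)` of the network.

This file is the machine-independent specification of that algorithm ON LISTS — exactly the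
functions a Turing machine computes (variables, values, bag indices are natural numbers; bags,
scopes, tables are lists; an assignment under construction is an association list) — and its
correctness theorem:

* data (with `allAssign`, `allAssignCap`, `assignOf`, `updList`, `parOf`, `bagOf` of
  `ListTreeDecomposition.lean`): `Table R`, `tabVal` (first entry with the given key, default `0`),
  `keptVars` (`bag t ∩ bag (parent t)`, the key variables of the message of `t`; `[]` at the root
  `0`), `privVars` (`bag t ∖ bag (parent t)`, the variables summed out at `t`), `homeOf` (the first
  bag containing a scope);
* the algorithm: `FactorOps` (scope and entry function of the factor symbols), `childMsgs`,
  `entryAt`, `mkTable`, `runDP` (bags `|bags|-1, …, 1, 0` in this order), `dpValue`;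
* the specification: `assignments D d` (the finite set of maps `ℕ → ℕ` with values `< d` on `D`
  and `0` elsewhere), `netValue O nv d fs = Σ_{a ∈ assignments (range nv) d} ∏_{φ ∈ fs} feval φ a`;
* the decompositions are the list-form rooted tree decompositions `ListTD.IsRootedTD nv par bags` of
  `Literature/Combinatorics/SimpleGraph/ListTreeDecomposition.lean` (parents carry smaller indices;
  (T3) in the rooted form "a vertex of bag `t` occurring in an earlier bag occurs in the parent
  bag"); the edge condition (T2) plays no role — what the algorithm needs is that every factor's
  scope lies in a bag (`homeOf < |bags|`);
* **`dpValue_eq_netValue`**: for a rooted decomposition housing every factor, entries depending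
  only on the scope, and a budget `cap ≥ d^{|bag t|}` for every bag, `dpValue = netValue`.

The proof is bucket elimination made formal: `sum_assignments_erase` (splitting the sum over
assignments at one variable), `sum_assignments_elimList` (summing out a list of variables on
which the rest of the product does not depend), and the invariant `Inv` of `runDP` — after the
bags `≥ t` are processed, `netValue` is the sum, over the assignments of the variables not yet
summed out, of the product of the factors housed above `t` and of the pending messages; the
variables summed out at `t` (`privVars`) occur in no factor housed above `t` and in no pending
message, by the rooted form of (T3).

## References

* I. L. Markov, Y. Shi, SIAM J. Comput. 38 (2008) 963–981, §4 (Thm. 4.6, Steps 3–4: contraction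
  along a tree decomposition; Prop. 4.2).
* R. Dechter, *Bucket elimination: a unifying framework for reasoning*, Artif. Intell. 113 (1999)
  41–85, §4 (the elimination step `Σ_{X} ∏ bucket`), §5 (complexity exponential in the induced
  width).
* S. Arnborg, A. Proskurowski, *Linear time algorithms for NP-hard problems restricted to partial
  k-trees*, Discrete Appl. Math. 23 (1989) 11–24 (dynamic programming over a rooted tree
  decomposition, tables indexed by the assignments of a bag).
-/

namespace Literature.LinearAlgebra.TensorNetworks

namespace JT

open Finset Literature.Combinatorics.SimpleGraph.ListTD

/-! ### Assignments as maps `ℕ → ℕ`: the finite set summed over -/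

/-- The assignments of values `< d` to the variables of `D` (all other variables carry `0`), as a
finite set of maps `ℕ → ℕ`. [folklore] -/
noncomputable def assignments (D : Finset ℕ) (d : ℕ) : Finset (ℕ → ℕ) := by
  classical exact (D.pi fun _ => Finset.range d).image fun f v => if h : v ∈ D then f v h else 0

/-- Membership in `assignments`. [folklore] -/
theorem mem_assignments {D : Finset ℕ} {d : ℕ} {a : ℕ → ℕ} :
    a ∈ assignments D d ↔ (∀ v ∈ D, a v < d) ∧ ∀ v ∉ D, a v = 0 := by
  classical
  unfold assignments
  constructor
  · intro h
    obtain ⟨f, hf, rfl⟩ := Finset.mem_image.1 h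
    rw [Finset.mem_pi] at hf
    refine ⟨fun v hv => ?_, fun v hv => ?_⟩
    · simp only [hv, dite_true]
      exact Finset.mem_range.1 (hf v hv)
    · simp [hv]
  · rintro ⟨h1, h2⟩
    refine Finset.mem_image.2 ⟨fun v _ => a v, Finset.mem_pi.2 fun v hv => Finset.mem_range.2 (h1 v hv), ?_⟩
    funext v
    by_cases hv : v ∈ D
    · simp [hv]
    · simp [hv, h2 v hv]

/-- The only assignment of no variables is the zero map. [folklore] -/
theorem assignments_empty (d : ℕ) : assignments ∅ d = {fun _ => 0} := by
  ext a
  rw [mem_assignments, Finset.mem_singleton]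
  constructor
  · rintro ⟨-, h⟩
    funext v
    exact h v (Finset.notMem_empty v)
  · rintro rfl
    exact ⟨fun v hv => absurd hv (Finset.notMem_empty v), fun _ _ => rfl⟩

/-- **Splitting the sum over assignments at one variable**: summing over the assignments of `D`
is summing over the assignments of `D ∖ {v}` and over the value of `v`. [folklore] -/
theorem sum_assignments_erase {M : Type*} [AddCommMonoid M] {D : Finset ℕ} {v : ℕ} (hv : v ∈ D)
    (d : ℕ) (F : (ℕ → ℕ) → M) :
    ∑ a ∈ assignments D d, F a =
      ∑ a ∈ assignments (D.erase v) d, ∑ x ∈ Finset.range d, F (Function.update a v x) := by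
  classical
  have himage : assignments D d =
      ((assignments (D.erase v) d) ×ˢ (Finset.range d)).image
        (fun p => Function.update p.1 v p.2) := by
    ext a
    rw [mem_assignments, Finset.mem_image]
    constructor
    · rintro ⟨h1, h2⟩
      have hb : Function.update a v 0 ∈ assignments (D.erase v) d := by
        rw [mem_assignments]
        refine ⟨fun w hw => ?_, fun w hw => ?_⟩
        · rw [Function.update_of_ne (Finset.ne_of_mem_erase hw)]
          exact h1 w (Finset.mem_of_mem_erase hw)
        · by_cases hwv : w = v
          · subst hwv; simp
          · rw [Function.update_of_ne hwv]
            exact h2 w fun h => hw (Finset.mem_erase.2 ⟨hwv, h⟩)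
      refine ⟨(Function.update a v 0, a v), Finset.mem_product.2 ⟨hb, Finset.mem_range.2 (h1 v hv)⟩, ?_⟩
      simp
    · rintro ⟨⟨b, x⟩, hbx, rfl⟩
      obtain ⟨hb, hx⟩ := Finset.mem_product.1 hbx
      rw [mem_assignments] at hb
      refine ⟨fun w hw => ?_, fun w hw => ?_⟩
      · by_cases hwv : w = v
        · subst hwv; simpa using Finset.mem_range.1 hx
        · rw [Function.update_of_ne hwv]
          exact hb.1 w (Finset.mem_erase.2 ⟨hwv, hw⟩)
      · have hwv : w ≠ v := fun h => hw (h ▸ hv)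
        rw [Function.update_of_ne hwv]
        exact hb.2 w fun h => hw (Finset.mem_of_mem_erase h)
  have hinj : Set.InjOn (fun p : (ℕ → ℕ) × ℕ => Function.update p.1 v p.2)
      ↑((assignments (D.erase v) d) ×ˢ (Finset.range d)) := by
    rintro ⟨b, x⟩ hbx ⟨b', x'⟩ hbx' h
    simp only [Finset.coe_product, Set.mem_prod, Finset.mem_coe, mem_assignments] at hbx hbx'
    have hx : x = x' := by simpa using congrFun h v
    subst hx
    have hb0 : b v = 0 := hbx.1.2 v (Finset.notMem_erase v D)
    have hb0' : b' v = 0 := hbx'.1.2 v (Finset.notMem_erase v D)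
    have : b = b' := by
      funext w
      by_cases hwv : w = v
      · subst hwv; rw [hb0, hb0']
      · simpa [Function.update_of_ne hwv] using congrFun h w
    rw [this]
  rw [himage, Finset.sum_image hinj, Finset.sum_product]

/-- **Summing out a list of variables** (bucket elimination, the step `Σ_X ∏ bucket` of Dechter
iterated): if `G` does not depend on the distinct variables `P ⊆ D`, then
`Σ_{a ∈ assignments D} G a · F a = Σ_{a ∈ assignments (D ∖ P)} G a · Σ_{pv} F (a overridden by pv)`.
[cite: Dechter1999, §4 (the elimination step)] -/
theorem sum_assignments_elimList {R : Type*} [CommSemiring R] (d : ℕ) (F : (ℕ → ℕ) → R) :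
    ∀ (P : List ℕ) (D : Finset ℕ) (G : (ℕ → ℕ) → R), P.Nodup → (∀ v ∈ P, v ∈ D) →
      (∀ v ∈ P, ∀ (a : ℕ → ℕ) (x : ℕ), G (Function.update a v x) = G a) →
      ∑ a ∈ assignments D d, G a * F a =
        ∑ a ∈ assignments (D \ P.toFinset) d, G a * ((allAssign d P).map fun pv => F (updList a P pv)).sum
  | [], D, G, _, _, _ => by simp [allAssign, updList]
  | v :: P, D, G, hnd, hPD, hG => by
    classical
    have hnd' : P.Nodup := (List.nodup_cons.1 hnd).2
    have hvP : v ∉ P := (List.nodup_cons.1 hnd).1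
    have ih := sum_assignments_elimList d F P D G hnd' (fun w hw => hPD w (List.mem_cons_of_mem v hw))
      (fun w hw => hG w (List.mem_cons_of_mem v hw))
    rw [ih]
    have hvD : v ∈ D \ P.toFinset := Finset.mem_sdiff.2 ⟨hPD v List.mem_cons_self, by simpa using hvP⟩
    rw [sum_assignments_erase hvD]
    have hset : (D \ P.toFinset).erase v = D \ (v :: P).toFinset := by
      ext w; simp [not_or, and_left_comm]
    rw [hset]
    refine Finset.sum_congr rfl fun a _ => ?_
    rw [sum_map_allAssign_cons, Finset.mul_sum]
    refine Finset.sum_congr rfl fun x _ => ?_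
    rw [hG v List.mem_cons_self]
    congr 1
    refine congrArg List.sum (List.map_congr_left fun pv _ => ?_)
    show F (updList (Function.update a v x) P pv) = F (Function.update (updList a P pv) v x)
    rw [updList_update a pv x hvP]


/-! ### Tables -/

/-- A **table**: a list of (key, entry) pairs, keys being value lists. [folklore] -/
abbrev Table (R : Type*) := List (List ℕ × R)

/-- **Reading a table**: the entry of the first pair with the given key, `0` if there is none.
[folklore] -/
def tabVal {R : Type*} [Zero R] (tab : Table R) (key : List ℕ) : R :=
  match tab.find? fun e => decide (e.1 = key) with
  | some e => e.2
  | none => 0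

/-- **A tabulated function reads back**: on a key of the index list, the table of `g` reads `g`.
[folklore] -/
theorem tabVal_map {R : Type*} [Zero R] (g : List ℕ → R) {keys : List (List ℕ)} {key : List ℕ}
    (h : key ∈ keys) : tabVal (keys.map fun k => (k, g k)) key = g key := by
  induction keys with
  | nil => simp at h
  | cons k keys ih =>
    unfold tabVal
    rw [List.map_cons, List.find?_cons]
    by_cases hk : k = key
    · subst hk; simp
    · have : decide ((k, g k).1 = key) = false := by simp [hk]
      rw [this]
      exact ih ((List.mem_cons.1 h).resolve_left (Ne.symm hk))

/-! ### Key and summed-out variables of a bag; homes of scopes -/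

/-- **The key variables of the message of `t`**: the variables of `bag t` that occur in the parent
bag (none at the root `0`). [cite: Dechter1999, §4 (the scope of the bucket's message)] -/
def keptVars (par : List ℕ) (bags : List (List ℕ)) (t : ℕ) : List ℕ :=
  if t = 0 then [] else (bagOf bags t).filter fun v => decide (v ∈ bagOf bags (parOf par t))

/-- **The variables summed out at `t`**: the variables of `bag t` not in the parent bag (all of
`bag 0` at the root). [cite: Dechter1999, §4 (the bucket's own variable)] -/
def privVars (par : List ℕ) (bags : List (List ℕ)) (t : ℕ) : List ℕ :=
  if t = 0 then bagOf bags 0 else (bagOf bags t).filter fun v => decide (v ∉ bagOf bags (parOf par t))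

/-- **The home of a scope**: the first bag containing it (`|bags|` if none does). [folklore] -/
def homeOf (bags : List (List ℕ)) (sc : List ℕ) : ℕ :=
  bags.findIdx fun B => sc.all fun v => decide (v ∈ B)

/-! ### Key and summed-out variables of a bag; homes of scopes -/

/-- A housed scope lies in its home bag. [folklore] -/
theorem subset_bagOf_homeOf {bags : List (List ℕ)} {sc : List ℕ} (h : homeOf bags sc < bags.length) :
    ∀ v ∈ sc, v ∈ bagOf bags (homeOf bags sc) := by
  have hp := List.findIdx_getElem (p := fun B => sc.all fun v => decide (v ∈ B)) (w := h)
  rw [List.all_eq_true] at hp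
  intro v hv
  rw [bagOf_eq_getElem h]
  have := hp v hv
  simp only [decide_eq_true_eq] at this
  exact this

/-- A scope lies in some bag iff it is housed. [folklore] -/
theorem homeOf_lt_length_iff {bags : List (List ℕ)} {sc : List ℕ} :
    homeOf bags sc < bags.length ↔ ∃ B ∈ bags, ∀ v ∈ sc, v ∈ B := by
  rw [homeOf, List.findIdx_lt_length]
  simp [List.all_eq_true]

/-- Key variables lie in the bag. [folklore] -/
theorem mem_bagOf_of_mem_keptVars {par : List ℕ} {bags : List (List ℕ)} {t v : ℕ}
    (h : v ∈ keptVars par bags t) : v ∈ bagOf bags t := by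
  unfold keptVars at h
  split_ifs at h with ht
  · simp at h
  · exact List.mem_of_mem_filter h

/-- Key variables lie in the parent bag, and there are none at the root. [folklore] -/
theorem mem_parent_of_mem_keptVars {par : List ℕ} {bags : List (List ℕ)} {t v : ℕ}
    (h : v ∈ keptVars par bags t) : t ≠ 0 ∧ v ∈ bagOf bags (parOf par t) := by
  unfold keptVars at h
  split_ifs at h with ht
  · simp at h
  · exact ⟨ht, by simpa using (List.mem_filter.1 h).2⟩

/-- Summed-out variables lie in the bag. [folklore] -/
theorem mem_bagOf_of_mem_privVars {par : List ℕ} {bags : List (List ℕ)} {t v : ℕ}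
    (h : v ∈ privVars par bags t) : v ∈ bagOf bags t := by
  unfold privVars at h
  split_ifs at h with ht
  · exact ht ▸ h
  · exact List.mem_of_mem_filter h

/-- Away from the root, summed-out variables do not lie in the parent bag. [folklore] -/
theorem not_mem_parent_of_mem_privVars {par : List ℕ} {bags : List (List ℕ)} {t v : ℕ} (ht : t ≠ 0)
    (h : v ∈ privVars par bags t) : v ∉ bagOf bags (parOf par t) := by
  unfold privVars at h
  rw [if_neg ht] at h
  simpa using (List.mem_filter.1 h).2

/-- A bag is the disjoint union of its key and its summed-out variables: membership.
[folklore] -/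
theorem mem_bagOf_iff {par : List ℕ} {bags : List (List ℕ)} {t v : ℕ} :
    v ∈ bagOf bags t ↔ v ∈ keptVars par bags t ∨ v ∈ privVars par bags t := by
  unfold keptVars privVars
  by_cases ht : t = 0
  · subst ht; simp
  · simp only [ht, if_false, List.mem_filter, decide_eq_true_eq]
    tauto

/-- Key and summed-out variables are disjoint. [folklore] -/
theorem not_mem_keptVars_of_mem_privVars {par : List ℕ} {bags : List (List ℕ)} {t v : ℕ}
    (h : v ∈ privVars par bags t) : v ∉ keptVars par bags t := by
  intro hk
  obtain ⟨ht, hp⟩ := mem_parent_of_mem_keptVars hk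
  exact not_mem_parent_of_mem_privVars ht h hp

/-- Key variables of a bag without repetitions have no repetitions. [folklore] -/
theorem nodup_keptVars {par : List ℕ} {bags : List (List ℕ)} {t : ℕ} (h : (bagOf bags t).Nodup) :
    (keptVars par bags t).Nodup := by
  unfold keptVars; split_ifs
  · exact List.nodup_nil
  · exact h.filter _

/-- Summed-out variables of a bag without repetitions have no repetitions. [folklore] -/
theorem nodup_privVars {par : List ℕ} {bags : List (List ℕ)} {t : ℕ} (h : (bagOf bags t).Nodup)
    (h0 : (bagOf bags 0).Nodup) : (privVars par bags t).Nodup := by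
  unfold privVars; split_ifs
  · exact h0
  · exact h.filter _

/-- The key variables are at most as many as the bag's. [folklore] -/
theorem length_keptVars_le (par : List ℕ) (bags : List (List ℕ)) (t : ℕ) :
    (keptVars par bags t).length ≤ (bagOf bags t).length := by
  unfold keptVars; split_ifs
  · exact Nat.zero_le _
  · exact List.length_filter_le _ _

/-- The summed-out variables are at most as many as the bag's. [folklore] -/
theorem length_privVars_le (par : List ℕ) (bags : List (List ℕ)) (t : ℕ) :
    (privVars par bags t).length ≤ (bagOf bags t).length := by
  unfold privVars; split_ifs with ht
  · exact ht ▸ le_rfl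
  · exact List.length_filter_le _ _

/-- **Reading the assignment assembled at a bag**: the association list "keys bound to `a`,
summed-out variables bound to `pv`" reads, on the bag, the map `a` overridden by `pv`.
[folklore] -/
theorem assignOf_keys_append_priv {par : List ℕ} {bags : List (List ℕ)} {t : ℕ} (a : ℕ → ℕ)
    {pv : List ℕ} (hlen : pv.length = (privVars par bags t).length) {v : ℕ} (hv : v ∈ bagOf bags t) :
    assignOf ((keptVars par bags t).zip ((keptVars par bags t).map a) ++ (privVars par bags t).zip pv) v =
      updList a (privVars par bags t) pv v := by
  rcases mem_bagOf_iff.1 hv with hk | hp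
  · have hnp : v ∉ privVars par bags t := fun hp => not_mem_keptVars_of_mem_privVars hp hk
    rw [assignOf_append_of_mem, assignOf_zip_map hk, updList_of_not_mem a pv hnp]
    rw [List.map_fst_zip]
    · exact hk
    · simp
  · have hnk : v ∉ keptVars par bags t := not_mem_keptVars_of_mem_privVars hp
    rw [assignOf_append_of_not_mem fun h => hnk (mem_of_mem_map_fst_zip h),
      assignOf_zip_eq_updList a hlen hp]

/-! ### The algorithm -/

/-- **Factor symbols**: the scope (a list of variables) and the entry function of each symbol
`φ : Φ` (read off a global assignment `ℕ → ℕ`; meant to depend on the scope only). [cite: Dechter1999, §2 (functions with scopes)] -/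
structure FactorOps (R : Type*) (Φ : Type*) where
  /-- The variables a factor reads. -/
  scope : Φ → List ℕ
  /-- The entry of a factor at an assignment. -/
  feval : Φ → (ℕ → ℕ) → R

variable {R : Type*} [CommSemiring R] {Φ : Type*}

/-- **The messages of the children of `t`** among the messages computed so far (pairs
(bag index, table); the root `0` is nobody's child). [cite: Dechter1999, §4] -/
def childMsgs (par : List ℕ) (msgs : List (ℕ × Table R)) (t : ℕ) : List (ℕ × Table R) :=
  msgs.filter fun m => decide (m.1 ≠ 0 ∧ parOf par m.1 = t)

/-- **The product at bag `t`** under the assignment `A` of its variables: the entries of the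
factors housed at `t` times the entries of the children's messages at their keys.
[cite: Dechter1999, §4 (∏ over the bucket)] -/
def entryAt (O : FactorOps R Φ) (par : List ℕ) (bags : List (List ℕ)) (fs : List Φ)
    (msgs : List (ℕ × Table R)) (t : ℕ) (A : List (ℕ × ℕ)) : R :=
  ((fs.filter fun φ => decide (homeOf bags (O.scope φ) = t)).map fun φ => O.feval φ (assignOf A)).prod *
    ((childMsgs par msgs t).map fun m => tabVal m.2 ((keptVars par bags m.1).map (assignOf A))).prod

/-- **The message of bag `t`**: for every value list of its key variables, the sum over the value
lists of its summed-out variables of the product at `t` (enumerations within the budget `cap`).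
[cite: Dechter1999, §4 (Σ_X ∏ bucket)] -/
def mkTable (O : FactorOps R Φ) (d cap : ℕ) (par : List ℕ) (bags : List (List ℕ)) (fs : List Φ)
    (msgs : List (ℕ × Table R)) (t : ℕ) : Table R :=
  (allAssignCap d cap (keptVars par bags t)).map fun kv =>
    (kv, ((allAssignCap d cap (privVars par bags t)).map fun pv =>
      entryAt O par bags fs msgs t
        ((keptVars par bags t).zip kv ++ (privVars par bags t).zip pv)).sum)

/-- One step: compute the message of `t` and record it. [cite: Dechter1999, §4] -/
def stepBag (O : FactorOps R Φ) (d cap : ℕ) (par : List ℕ) (bags : List (List ℕ)) (fs : List Φ)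
    (t : ℕ) (msgs : List (ℕ × Table R)) : List (ℕ × Table R) :=
  (t, mkTable O d cap par bags fs msgs t) :: msgs

/-- **The run**: bags `|bags| - 1, …, 1, 0`, children before parents. [cite: Dechter1999, §4 (buckets processed along the ordering)] -/
def runDP (O : FactorOps R Φ) (d cap : ℕ) (par : List ℕ) (bags : List (List ℕ)) (fs : List Φ) :
    List (ℕ × Table R) :=
  (List.range bags.length).foldr (stepBag O d cap par bags fs) []

/-- **The computed value**: the single entry of the root's message. [cite: Dechter1999, §4] -/
def dpValue (O : FactorOps R Φ) (d cap : ℕ) (par : List ℕ) (bags : List (List ℕ)) (fs : List Φ) : R :=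
  match runDP O d cap par bags fs with
  | [] => 0
  | m :: _ => tabVal m.2 []

/-- **The value of a list network** on the variables `< nv` over the domain `{0, …, d-1}`:
`Σ_a ∏_{φ ∈ fs} feval φ a`. [cite: Dechter1999, §2 (sum-of-products)] -/
noncomputable def netValue (O : FactorOps R Φ) (nv d : ℕ) (fs : List Φ) : R :=
  ∑ a ∈ assignments (Finset.range nv) d, (fs.map fun φ => O.feval φ a).prod

/-! ### Correctness -/

/-- Splitting a filtered product along a disjoint disjunction of the filter. [folklore] -/
theorem prod_map_filter_split {α M : Type*} [CommMonoid M] (f : α → M) (p q r : α → Bool)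
    (hr : ∀ x, r x = (p x || q x)) (hpq : ∀ x, p x = true → q x = false) (l : List α) :
    ((l.filter r).map f).prod = ((l.filter p).map f).prod * ((l.filter q).map f).prod := by
  induction l with
  | nil => simp
  | cons x l ih =>
    have hrx := hr x
    cases hp : p x <;> cases hq : q x
    · simp [hrx, hp, hq, ih]
    · simp [hrx, hp, hq, ih, mul_left_comm]
    · simp [hrx, hp, hq, ih, mul_assoc]
    · rw [hpq x hp] at hq; exact absurd hq Bool.false_ne_true

section Correctness

variable (O : FactorOps R Φ) (d cap nv : ℕ) (par : List ℕ) (bags : List (List ℕ)) (fs : List Φ)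

/-- The messages computed for the bags `≥ t`. [folklore] -/
def dpFrom (t : ℕ) : List (ℕ × Table R) :=
  (List.range' t (bags.length - t)).foldr (stepBag O d cap par bags fs) []

/-- Nothing is computed beyond the last bag. [folklore] -/
theorem dpFrom_length : dpFrom O d cap par bags fs bags.length = [] := by
  simp [dpFrom]

/-- One more bag. [folklore] -/
theorem dpFrom_of_lt {t : ℕ} (ht : t < bags.length) :
    dpFrom O d cap par bags fs t = stepBag O d cap par bags fs t (dpFrom O d cap par bags fs (t + 1)) := by
  have h : bags.length - t = (bags.length - (t + 1)) + 1 := by omega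
  rw [dpFrom, h, List.range'_succ, List.foldr_cons]
  rfl

/-- The run is the computation from bag `0`. [folklore] -/
theorem runDP_eq_dpFrom : runDP O d cap par bags fs = dpFrom O d cap par bags fs 0 := by
  rw [runDP, dpFrom, List.range_eq_range', Nat.sub_zero]

/-- **The live variables** after the bags `≥ t` are processed: those not summed out yet.
[cite: Dechter1999, §4] -/
noncomputable def liveVars (t : ℕ) : Finset ℕ :=
  Finset.range nv \ (Finset.Ico t bags.length).biUnion fun c => (privVars par bags c).toFinset

/-- Initially every variable is live. [folklore] -/
theorem liveVars_length : liveVars nv par bags bags.length = Finset.range nv := by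
  simp [liveVars]

/-- Processing bag `t` removes its summed-out variables from the live ones. [folklore] -/
theorem liveVars_succ_sdiff {t : ℕ} (ht : t < bags.length) :
    liveVars nv par bags (t + 1) \ (privVars par bags t).toFinset = liveVars nv par bags t := by
  have hIco : Finset.Ico t bags.length = insert t (Finset.Ico (t + 1) bags.length) := by
    ext c; simp only [Finset.mem_Ico, Finset.mem_insert]; omega
  rw [liveVars, liveVars, hIco, Finset.biUnion_insert, sdiff_sdiff_left, sup_comm]
  rfl

variable {nv par bags}

/-- A vertex of bag `t` is summed out at no later bag. [folklore] -/
theorem not_mem_privVars_of_lt (hD : IsRootedTD nv par bags) {v t c : ℕ} (htc : t < c)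
    (hc : c < bags.length) (hv : v ∈ bagOf bags t) : v ∉ privVars par bags c := fun hp =>
  not_mem_parent_of_mem_privVars (by omega) hp (hD.rooted v t c htc hc (mem_bagOf_of_mem_privVars hp) hv)

/-- A vertex of bag `t` not summed out at `t` is live after `t` is processed. [folklore] -/
theorem mem_liveVars_of_mem_bagOf (hD : IsRootedTD nv par bags) {v t : ℕ}
    (hv : v ∈ bagOf bags t) (hnp : v ∉ privVars par bags t) : v ∈ liveVars nv par bags t := by
  simp only [liveVars, Finset.mem_sdiff, Finset.mem_range, Finset.mem_biUnion, Finset.mem_Ico,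
    List.mem_toFinset, not_exists, not_and, and_imp]
  refine ⟨Finset.mem_range.1 (hD.bag_mem t v hv), fun c htc hc => ?_⟩
  rcases Nat.eq_or_lt_of_le htc with rfl | hlt
  · exact hnp
  · exact not_mem_privVars_of_lt hD hlt hc hv

/-- The summed-out variables of `t` are live before `t` is processed. [folklore] -/
theorem mem_liveVars_succ_of_mem_privVars (hD : IsRootedTD nv par bags) {v t : ℕ}
    (hv : v ∈ privVars par bags t) : v ∈ liveVars nv par bags (t + 1) := by
  simp only [liveVars, Finset.mem_sdiff, Finset.mem_range, Finset.mem_biUnion, Finset.mem_Ico,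
    List.mem_toFinset, not_exists, not_and, and_imp]
  exact ⟨Finset.mem_range.1 (hD.bag_mem t v (mem_bagOf_of_mem_privVars hv)), fun c htc hc =>
    not_mem_privVars_of_lt hD (by omega) hc (mem_bagOf_of_mem_privVars hv)⟩

/-- **Finally no variable is live**: every vertex is summed out at the first bag containing it.
[folklore] -/
theorem liveVars_zero (hD : IsRootedTD nv par bags) : liveVars nv par bags 0 = ∅ := by
  classical
  ext v
  simp only [liveVars, Finset.mem_sdiff, Finset.mem_range, Finset.mem_biUnion, Finset.mem_Ico,
    List.mem_toFinset, zero_le, true_and, not_exists, not_and, Finset.notMem_empty, iff_false]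
  intro hv h
  have hex : ∃ t, t < bags.length ∧ v ∈ bagOf bags t := hD.cover v (Finset.mem_range.2 hv)
  set m := Nat.find hex with hm
  obtain ⟨hmlt, hvm⟩ := Nat.find_spec hex
  refine h m hmlt ?_
  unfold privVars
  split_ifs with hm0
  · rwa [← hm0]
  · refine List.mem_filter.2 ⟨hvm, ?_⟩
    simp only [decide_eq_true_eq]
    intro hvp
    have hlt := hD.par_lt m (Nat.pos_of_ne_zero hm0) hmlt
    exact Nat.find_min hex hlt ⟨hlt.trans hmlt, hvp⟩

/-- Summed-out variables occur in no factor housed at an earlier bag. [folklore] -/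
theorem not_mem_scope_of_homeOf_lt (hD : IsRootedTD nv par bags) {sc : List ℕ} {v t : ℕ}
    (ht : t < bags.length) (hs : homeOf bags sc < t) (hv : v ∈ privVars par bags t) : v ∉ sc := by
  intro hvs
  have hvb := subset_bagOf_homeOf (hs.trans ht) v hvs
  have ht0 : t ≠ 0 := by omega
  exact not_mem_parent_of_mem_privVars ht0 hv
    (hD.rooted v _ t hs ht (mem_bagOf_of_mem_privVars hv) hvb)

/-- Summed-out variables of `t` are not key variables of a bag whose parent is earlier than `t`.
[folklore] -/
theorem not_mem_keptVars_of_parent_lt (hD : IsRootedTD nv par bags) {v t c : ℕ}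
    (ht : t < bags.length) (hc : parOf par c < t) (hv : v ∈ privVars par bags t) :
    v ∉ keptVars par bags c := by
  intro hk
  obtain ⟨-, hvp⟩ := mem_parent_of_mem_keptVars hk
  have ht0 : t ≠ 0 := by omega
  exact not_mem_parent_of_mem_privVars ht0 hv
    (hD.rooted v _ t hc ht (mem_bagOf_of_mem_privVars hv) hvp)

variable (nv par bags)

/-- **The invariant of the run** after the bags `≥ t` are processed: the messages are those of
the bags `t, …, |bags|-1`, and the value of the network is the sum over the assignments of the
live variables of (the product of the factors housed before `t`) times (the entries of the
pending messages — those of the root and of the bags whose parent is before `t`).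
[cite: Dechter1999, §4 (correctness of bucket elimination)] -/
def Inv (t : ℕ) (msgs : List (ℕ × Table R)) : Prop :=
  msgs.map Prod.fst = List.range' t (bags.length - t) ∧
  netValue O nv d fs = ∑ a ∈ assignments (liveVars nv par bags t) d,
    ((fs.filter fun φ => decide (homeOf bags (O.scope φ) < t)).map fun φ => O.feval φ a).prod *
    ((msgs.filter fun m => decide (m.1 = 0 ∨ parOf par m.1 < t)).map
      fun m => tabVal m.2 ((keptVars par bags m.1).map a)).prod

variable {O d cap nv par bags fs}

/-- The invariant holds before the run. [folklore] -/
theorem inv_length (hhome : ∀ φ ∈ fs, homeOf bags (O.scope φ) < bags.length) :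
    Inv O d nv par bags fs bags.length [] := by
  refine ⟨by simp, ?_⟩
  rw [liveVars_length, netValue]
  refine Finset.sum_congr rfl fun a _ => ?_
  rw [List.filter_nil, List.map_nil, List.prod_nil, mul_one, List.filter_eq_self.2]
  intro φ hφ
  simpa using hhome φ hφ

/-- **The step**: processing bag `t` preserves the invariant. [cite: Dechter1999, §4 (Σ_X ∏ bucket preserves the value)] -/
theorem inv_step (hD : IsRootedTD nv par bags) (hd : 0 < d)
    (hloc : ∀ φ ∈ fs, ∀ a b : ℕ → ℕ, (∀ v ∈ O.scope φ, a v = b v) → O.feval φ a = O.feval φ b)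
    (hcap : ∀ t, t < bags.length → d ^ (bagOf bags t).length ≤ cap)
    {t : ℕ} (ht : t < bags.length) {msgs : List (ℕ × Table R)} (h : Inv O d nv par bags fs (t + 1) msgs) :
    Inv O d nv par bags fs t (stepBag O d cap par bags fs t msgs) := by
  classical
  obtain ⟨hfst, hval⟩ := h
  -- the indices of the recorded messages
  have hidx : ∀ m ∈ msgs, t + 1 ≤ m.1 ∧ m.1 < bags.length := by
    intro m hm
    have : m.1 ∈ msgs.map Prod.fst := List.mem_map_of_mem hm
    rw [hfst, List.mem_range'] at this
    omega
  refine ⟨?_, ?_⟩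
  · have hn : bags.length - t = (bags.length - (t + 1)) + 1 := by omega
    rw [stepBag, List.map_cons, hfst, hn, List.range'_succ]
  -- abbreviations
  set K := keptVars par bags t with hK
  set P := privVars par bags t with hP
  set T := mkTable O d cap par bags fs msgs t with hT
  set A' : (ℕ → ℕ) → R := fun a =>
    ((fs.filter fun φ => decide (homeOf bags (O.scope φ) < t)).map fun φ => O.feval φ a).prod with hA'
  set At : (ℕ → ℕ) → R := fun a =>
    ((fs.filter fun φ => decide (homeOf bags (O.scope φ) = t)).map fun φ => O.feval φ a).prod with hAt
  set B' : (ℕ → ℕ) → R := fun a =>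
    ((msgs.filter fun m => decide (m.1 = 0 ∨ parOf par m.1 < t)).map
      fun m => tabVal m.2 ((keptVars par bags m.1).map a)).prod with hB'
  set Bt : (ℕ → ℕ) → R := fun a =>
    ((childMsgs par msgs t).map fun m => tabVal m.2 ((keptVars par bags m.1).map a)).prod with hBt
  -- (S1)-(S2): split the two products of the invariant at `t + 1`
  have hsplitA : ∀ a, ((fs.filter fun φ => decide (homeOf bags (O.scope φ) < t + 1)).map
      fun φ => O.feval φ a).prod = A' a * At a := fun a =>
    prod_map_filter_split _ (fun φ => decide (homeOf bags (O.scope φ) < t))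
      (fun φ => decide (homeOf bags (O.scope φ) = t)) _
      (fun φ => by rw [Bool.eq_iff_iff]; simp only [Bool.or_eq_true, decide_eq_true_eq]; omega)
      (fun φ hp => by simp only [decide_eq_true_eq] at hp; simp only [decide_eq_false_iff_not]; omega) fs
  have hfilt : (msgs.filter fun m => decide (m.1 = 0 ∨ parOf par m.1 < t + 1)) =
      msgs.filter fun m => (decide (m.1 ≠ 0 ∧ parOf par m.1 = t) || decide (m.1 = 0 ∨ parOf par m.1 < t)) := by
    refine List.filter_congr fun m hm => ?_
    have := hidx m hm
    rw [Bool.eq_iff_iff]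
    simp only [Bool.or_eq_true, decide_eq_true_eq]
    omega
  have hsplitB : ∀ a, ((msgs.filter fun m => decide (m.1 = 0 ∨ parOf par m.1 < t + 1)).map
      fun m => tabVal m.2 ((keptVars par bags m.1).map a)).prod = Bt a * B' a := fun a => by
    rw [hfilt]
    exact prod_map_filter_split (fun m : ℕ × Table R => tabVal m.2 ((keptVars par bags m.1).map a))
      (fun m => decide (m.1 ≠ 0 ∧ parOf par m.1 = t))
      (fun m => decide (m.1 = 0 ∨ parOf par m.1 < t)) _ (fun m => rfl)
      (fun m hp => by simp only [decide_eq_true_eq] at hp; simp only [decide_eq_false_iff_not]; omega) msgs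
  -- (S3): sum out the private variables of `t`
  have hPnd : P.Nodup := nodup_privVars (hD.bag_nodup t) (hD.bag_nodup 0)
  have hPD : ∀ v ∈ P, v ∈ liveVars nv par bags (t + 1) := fun v hv =>
    mem_liveVars_succ_of_mem_privVars hD hv
  have hG : ∀ v ∈ P, ∀ (a : ℕ → ℕ) (x : ℕ), A' (Function.update a v x) * B' (Function.update a v x) =
      A' a * B' a := by
    intro v hv a x
    congr 1
    · simp only [hA']
      congr 1
      refine List.map_congr_left fun φ hφ => ?_
      obtain ⟨hφfs, hφt⟩ := List.mem_filter.1 hφ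
      simp only [decide_eq_true_eq] at hφt
      refine hloc φ hφfs _ _ fun w hw => Function.update_of_ne ?_ _ _
      rintro rfl
      exact not_mem_scope_of_homeOf_lt hD ht hφt hv hw
    · simp only [hB']
      congr 1
      refine List.map_congr_left fun m hm => ?_
      obtain ⟨hmm, hmt⟩ := List.mem_filter.1 hm
      simp only [decide_eq_true_eq] at hmt
      have hpar : parOf par m.1 < t := by
        rcases hmt with h0 | h
        · have := hidx m hmm; omega
        · exact h
      congr 1
      refine List.map_congr_left fun w hw => Function.update_of_ne ?_ _ _
      rintro rfl
      exact not_mem_keptVars_of_parent_lt hD ht hpar hv hw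
  have hstep := sum_assignments_elimList d (fun a => At a * Bt a) P (liveVars nv par bags (t + 1))
    (fun a => A' a * B' a) hPnd hPD hG
  -- (S5): the new table holds these sums
  have hcapK : d ^ K.length ≤ cap :=
    (Nat.pow_le_pow_right hd (length_keptVars_le par bags t)).trans (hcap t ht)
  have hcapP : d ^ P.length ≤ cap :=
    (Nat.pow_le_pow_right hd (length_privVars_le par bags t)).trans (hcap t ht)
  have htab : ∀ a ∈ assignments (liveVars nv par bags t) d,
      tabVal T (K.map a) = ((allAssign d P).map fun pv => At (updList a P pv) * Bt (updList a P pv)).sum := by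
    intro a ha
    rw [mem_assignments] at ha
    have hkey : K.map a ∈ allAssign d K := by
      refine mem_allAssign.2 ⟨List.length_map _, fun x hx => ?_⟩
      obtain ⟨v, hv, rfl⟩ := List.mem_map.1 hx
      refine ha.1 v (mem_liveVars_of_mem_bagOf hD (mem_bagOf_of_mem_keptVars hv) fun hp => ?_)
      exact not_mem_keptVars_of_mem_privVars hp hv
    rw [hT, mkTable, allAssignCap_eq hcapK, allAssignCap_eq hcapP, tabVal_map _ hkey]
    congr 1
    refine List.map_congr_left fun pv hpv => ?_
    have hlen : pv.length = P.length := (mem_allAssign.1 hpv).1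
    have hread : ∀ w ∈ bagOf bags t,
        assignOf (K.zip (K.map a) ++ P.zip pv) w = updList a P pv w := fun w hw =>
      assignOf_keys_append_priv a hlen hw
    rw [entryAt]
    congr 1
    · simp only [hAt]
      congr 1
      refine List.map_congr_left fun φ hφ => ?_
      obtain ⟨hφfs, hφt⟩ := List.mem_filter.1 hφ
      simp only [decide_eq_true_eq] at hφt
      refine hloc φ hφfs _ _ fun w hw => hread w ?_
      exact hφt ▸ subset_bagOf_homeOf (hφt ▸ ht) w hw
    · simp only [hBt]
      congr 1
      refine List.map_congr_left fun m hm => ?_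
      obtain ⟨-, hmt⟩ := List.mem_filter.1 hm
      simp only [decide_eq_true_eq] at hmt
      congr 1
      refine List.map_congr_left fun w hw => hread w ?_
      exact hmt.2 ▸ (mem_parent_of_mem_keptVars hw).2
  -- (S6): assemble
  rw [hval]
  simp_rw [hsplitA, hsplitB]
  have hre : ∀ a, A' a * At a * (Bt a * B' a) = (A' a * B' a) * (At a * Bt a) := fun a => by ring
  simp_rw [hre]
  rw [hstep, liveVars_succ_sdiff nv par bags ht]
  refine Finset.sum_congr rfl fun a ha => ?_
  rw [← htab a ha]
  have hpend : t = 0 ∨ parOf par t < t := by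
    rcases Nat.eq_zero_or_pos t with h0 | hpos
    · exact Or.inl h0
    · exact Or.inr (hD.par_lt t hpos ht)
  rw [stepBag, List.filter_cons, if_pos (by simp only [decide_eq_true_eq]; exact hpend), List.map_cons,
    List.prod_cons]
  simp only [hA', hB']
  ring

/-- The invariant after the whole run. [folklore] -/
theorem inv_dpFrom (hD : IsRootedTD nv par bags) (hd : 0 < d)
    (hhome : ∀ φ ∈ fs, homeOf bags (O.scope φ) < bags.length)
    (hloc : ∀ φ ∈ fs, ∀ a b : ℕ → ℕ, (∀ v ∈ O.scope φ, a v = b v) → O.feval φ a = O.feval φ b)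
    (hcap : ∀ t, t < bags.length → d ^ (bagOf bags t).length ≤ cap) :
    ∀ k t, t + k = bags.length → Inv O d nv par bags fs t (dpFrom O d cap par bags fs t)
  | 0, t, h => by
    rw [Nat.add_zero] at h
    subst h
    rw [dpFrom_length]
    exact inv_length hhome
  | k + 1, t, h => by
    have ht : t < bags.length := by omega
    rw [dpFrom_of_lt O d cap par bags fs ht]
    exact inv_step hD hd hloc hcap ht (inv_dpFrom hD hd hhome hloc hcap k (t + 1) (by omega))

/-- **Correctness of the junction-tree evaluation** (Markov–Shi's Thm. 4.6, Steps 3–4, in the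
sum-of-products form; Dechter's bucket elimination): along a rooted tree decomposition (list
form) housing every factor, with entries depending on the scope only, a nonempty domain and an
enumeration budget of at least `d^{|bag|}` for every bag, the computed value is the value of the
network. [cite: MarkovShi2008, §4 (Thm 4.6, Steps 3–4; Prop 4.2)] -/
theorem dpValue_eq_netValue (hD : IsRootedTD nv par bags) (hd : 0 < d)
    (hhome : ∀ φ ∈ fs, homeOf bags (O.scope φ) < bags.length)
    (hloc : ∀ φ ∈ fs, ∀ a b : ℕ → ℕ, (∀ v ∈ O.scope φ, a v = b v) → O.feval φ a = O.feval φ b)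
    (hcap : ∀ t, t < bags.length → d ^ (bagOf bags t).length ≤ cap) :
    dpValue O d cap par bags fs = netValue O nv d fs := by
  classical
  obtain ⟨hfst, hval⟩ := inv_dpFrom hD hd hhome hloc hcap bags.length 0 (Nat.zero_add _)
  rw [← runDP_eq_dpFrom] at hfst hval
  -- the run records the root's message first
  have hn : bags.length - 0 = (bags.length - 1) + 1 := by have := hD.pos; omega
  rw [hn, List.range'_succ] at hfst
  obtain ⟨m, rest, hrun, hm, hrest⟩ : ∃ m rest, runDP O d cap par bags fs = m :: rest ∧ m.1 = 0 ∧
      rest.map Prod.fst = List.range' (0 + 1) (bags.length - 1) := by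
    cases hr : runDP O d cap par bags fs with
    | nil => rw [hr] at hfst; simp at hfst
    | cons m rest =>
      rw [hr, List.map_cons, List.cons.injEq] at hfst
      exact ⟨m, rest, rfl, hfst.1, hfst.2⟩
  rw [dpValue, hrun]
  rw [hval, liveVars_zero hD, assignments_empty, Finset.sum_singleton, hrun]
  have hfac : (fs.filter fun φ => decide (homeOf bags (O.scope φ) < 0)) = [] :=
    List.filter_eq_nil_iff.2 fun φ _ => by simp
  have hrest0 : ∀ m' ∈ rest, ¬ (m'.1 = 0 ∨ parOf par m'.1 < 0) := by
    intro m' hm'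
    have : m'.1 ∈ rest.map Prod.fst := List.mem_map_of_mem hm'
    rw [hrest, List.mem_range'] at this
    omega
  rw [hfac, List.map_nil, List.prod_nil, one_mul, List.filter_cons_of_pos (by simp [hm]),
    List.filter_eq_nil_iff.2 fun m' hm' => by simpa using hrest0 m' hm']
  simp [hm, keptVars]

end Correctness

end JT

end Literature.LinearAlgebra.TensorNetworks
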